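import Literature.AlgebraicGeometry.Resolution.LocalUniformizationAbhyankarPlaces
import Literature.AlgebraicGeometry.Resolution.RegularLocusPerfectField
import HarnessLib

/-!
# The crux `IndSmooth.ValuativeSmoothing` holds at every Abhyankar place
# (Knaf–Kuhlmann 2005, Thm. 1.1 and Cor. 2.2)

Support file for crux stmt-ResolutionOfSingularities-16087 (`ValuativeSmoothing`, route file
`Theses/IndSmooth.lean`): for `k` PERFECT (no characteristic hypothesis), `K/k` finitely
generated, `O ⊇ k` a valuation ring of `K` which is an ABHYANKAR place of `K | k` (equality in
Abhyankar's inequality, `Literature.AlgebraicGeometry.Resolution.IsAbhyankarPlace`) and a finitely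
generated `k`-subalgebra `R ⊆ O`, the inclusion `R → O` factors as `R → T → O` through a SMOOTH
`k`-algebra `T` — the conclusion of `ValuativeSmoothing` at `O` (here even with `T ⊆ K` a finitely
generated subalgebra and both maps inclusions).

**Proof.** Relative local uniformization at Abhyankar places over a perfect field
(`relLU_at_abhyankarPlace_of_perfectField`, PROVED in the tree from Knaf–Kuhlmann 2005, Thm. 1.1
and Cor. 2.2) gives a finitely generated `A` with `R ≤ A ⊆ O` which is regular at the centre
`𝔮 = 𝔪_O ∩ A`. Over the perfect field `k`, regular at `𝔮` means smooth at `𝔮`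
(`isSmoothAt_iff_isRegularLocalRing_of_perfectField`, Matsumura §30 Remark 2), and smoothness at a
prime spreads to a basic open neighbourhood (`Algebra.IsSmoothAt.exists_notMem_smooth`, Stacks
00TB): `A_f` is smooth over `k` for some `f ∈ A ∖ 𝔮`. As `f ∉ 𝔮`, `f` is a unit of `O`, so
`T := A[1/f] ⊆ O` (`locAway`, `locAway_le_valuationSubring`, `smooth_locAway`), and
`R ≤ A ≤ T ⊆ O`.

## Sources

* H. Knaf, F.-V. Kuhlmann, *Abhyankar places admit local uniformization in any
  characteristic*, Ann. Sci. ÉNS 38 (2005) 833–846: Thm. 1.1, Cor. 2.2. [KnafKuhlmann2005]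
* H. Matsumura, *Commutative Ring Theory* (1987), §30, Remark 2 after Thm. 30.3. [Matsumura1987]
-/

-- single-problem summit: the doubled namespace component is forced
set_option linter.dupNamespace false

namespace Summit.ResolutionOfSingularities.ResolutionOfSingularities.Theorems.ValuativeSmoothing

open IsLocalRing Literature.AlgebraicGeometry.Resolution

/-- **The crux `ValuativeSmoothing` holds at every Abhyankar place** (Knaf–Kuhlmann 2005,
Thm. 1.1 with Cor. 2.2, over a perfect ground field, in the vocabulary of crux
stmt-ResolutionOfSingularities-16087): for `k` perfect, `K/k` finitely generated, `O ⊇ k` a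
valuation ring of `K` which is an Abhyankar place of `K | k` and `R ⊆ O` a finitely generated
`k`-subalgebra, the inclusion `R → O` factors as `R → T → O ⊆ K` through a smooth `k`-algebra `T`.
Relative local uniformization at `O` (`relLU_at_abhyankarPlace_of_perfectField`) gives a finitely
generated `A`, `R ≤ A ⊆ O`, regular at the centre `𝔮`; over the perfect field `k` this means
smooth at `𝔮` (`isSmoothAt_iff_isRegularLocalRing_of_perfectField`), hence `A_f` is smooth for
some `f ∈ A ∖ 𝔮` (openness of the smooth locus, `Algebra.IsSmoothAt.exists_notMem_smooth`); `f`
is a unit of `O`, so `T := A[1/f] ⊆ O`, and `R ≤ A ≤ T` with the inclusions `R → T → K`.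
[cite: KnafKuhlmann2005, Thm. 1.1 and Cor. 2.2] -/
theorem smoothFactor_of_isAbhyankarPlace {k K : Type} [Field k] [PerfectField k] [Field K]
    [Algebra k K] (hKfg : (⊤ : IntermediateField k K).FG) (O : ValuationSubring K)
    (hO : ∀ c : k, algebraMap k K c ∈ O)
    (hAbh : Literature.AlgebraicGeometry.Resolution.IsAbhyankarPlace O
      (algebraMap k K).fieldRange ⊤)
    (R : Subalgebra k K) (hRfg : R.FG) (hRO : R.toSubring ≤ O.toSubring) :
    ∃ (T : Type) (_ : CommRing T) (_ : Algebra k T), Algebra.Smooth k T ∧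
      ∃ (ψ : R →ₐ[k] T) (χ : T →ₐ[k] K), (∀ t : T, χ t ∈ O) ∧ ∀ r : R, χ (ψ r) = (r : K) := by
  -- Knaf–Kuhlmann 2005: a finitely generated `A`, `R ≤ A ⊆ O`, regular at the centre
  obtain ⟨A, hAO, hRA, hAfg, -, hreg⟩ :=
    relLU_at_abhyankarPlace_of_perfectField hKfg O hO hAbh R hRfg hRO
  haveI : Algebra.FiniteType k A := (Subalgebra.fg_iff_finiteType A).mp hAfg
  haveI : Algebra.FinitePresentation k A := (Algebra.FinitePresentation.of_finiteType).mp ‹_›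
  -- regular at the centre over the perfect field `k` ⇒ smooth at the centre
  haveI : Algebra.IsSmoothAt k (centre A O hAO) :=
    (isSmoothAt_iff_isRegularLocalRing_of_perfectField k A (centre A O hAO)).mpr hreg
  -- the smooth locus is open: `A_f` is smooth for some `f` outside the centre
  obtain ⟨f, hfq, hfsm⟩ := Algebra.IsSmoothAt.exists_notMem_smooth k (centre A O hAO)
  -- `f` is a unit of `O`
  have hvf : O.valuation (f : K) = 1 := by
    have h1 : O.valuation (f : K) ≤ 1 := (O.valuation_le_one_iff _).mpr (hAO f.2)
    have h2 : ¬ O.valuation (f : K) < 1 := fun hlt => hfq ((mem_centre_iff A O hAO f).mpr hlt)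
    exact le_antisymm h1 (not_lt.mp h2)
  have hf0 : (f : K) ≠ 0 := fun h0 => by simp [h0] at hvf
  -- `T := A[1/f] ⊆ O` is smooth over `k`, and `R ≤ A ≤ T`
  have hT : Algebra.Smooth k (locAway A (f : K) f.2) := smooth_locAway hf0 (by simpa using hfsm)
  have hTO : (locAway A (f : K) f.2).toSubring ≤ O.toSubring := locAway_le_valuationSubring hAO hvf
  exact ⟨locAway A (f : K) f.2, inferInstance, inferInstance, hT,
    Subalgebra.inclusion (hRA.trans le_locAway), (locAway A (f : K) f.2).val, fun t => hTO t.2,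
    fun _ => rfl⟩

end Summit.ResolutionOfSingularities.ResolutionOfSingularities.Theorems.ValuativeSmoothing
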